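import Summits.ResolutionOfSingularities.ResolutionOfSingularities.Theorems.PAlterationAssembly
import Summits.ResolutionOfSingularities.ResolutionOfSingularities.Theorems.PAlterationPalterationThesisGlue
import Summits.ResolutionOfSingularities.ResolutionOfSingularities.Theorems.PAlterationPicoverIffDegP
import HarnessLib

/-!
# Crux `PalterationThesis` (stmt-ResolutionOfSingularities-0552) is EQUIVALENT to the summit,
# prime by prime

Route `ResolutionOfSingularities/pAlteration`. The crux `PalterationThesis` is, prime by prime, the
conjunction `PIAlt_p ∧ PICover_p` of the cruxes `Pialt` (stmt-0555, the Abramovich–Oort conjecture)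
and `Picover` (stmt-0554, resolution of finite radicial covers of regular varieties). Two results of
the route are already in the tree:

* the ASSEMBLY `hasResolution_of_thesis` / `assembly_proof` (stmt-0553, `PAlterationAssembly.lean`):
  for a fixed prime `p`, `PIAlt_p ∧ PICover_p` gives resolution of every integral separated scheme
  of finite type over EVERY field of characteristic `p` (level models + relative Frobenius; no
  `F`-finiteness hypothesis);
* the SANDWICH `pialtAt_of_resolutionInChar` / `picoverAt_of_resolutionInChar`
  (`PAlterationPalterationThesisGlue.lean`): resolution in characteristic `p` gives each conjunct.

This file composes them into the sharp statement of where the crux sits: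

* `palterationThesisAt_iff_resolutionInChar` — for EACH prime `p` separately,
  `PIAlt_p ∧ PICover_p ↔ ResolutionInChar p`;
* `palterationThesis_iff_resolutionOfSingularities` — `PalterationThesis ↔ ResolutionOfSingularities`
  (the crux is literally summit-equivalent: it can be neither proved nor refuted short of settling
  resolution of singularities in positive characteristic, and every partial result on one side is a
  partial result on the other);
* `resolutionOfSingularities_iff_pialt_and_picover` — the summit restated as the conjunction of the
  route's two research cruxes stmt-0555 and stmt-0554;
* `palterationThesis_iff_pialt_and_picoverDegP` — the crux with its `Picover` half replaced by the
  degree-`p` residue of the line `degree-p-tower` (`picover_iff_picoverDegP`, landed on stmt-0554):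
  purely inseparable regular alterations AND resolution of `normalizationIn W L` for `W` regular and
  `L / K(W)` purely inseparable of degree `p`.
-/

set_option linter.dupNamespace false -- mandated namespace of this single-conjunct summit

namespace Summit.ResolutionOfSingularities.ResolutionOfSingularities.Theorems

open CategoryTheory AlgebraicGeometry
open Literature.AlgebraicGeometry.Resolution
open Summit.ResolutionOfSingularities.ResolutionOfSingularities.Theses.PAlteration

/-- **Prime by prime, the thesis is resolution in characteristic `p`.** For a prime `p`,
`PIAlt_p ∧ PICover_p` (purely inseparable regular alterations of all integral varieties in
characteristic `p`, and resolution of finite radicial covers of regular varieties in characteristic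
`p`) holds if and only if every reduced separated scheme of finite type over every field of
characteristic `p` has a resolution (`ResolutionInChar p`). Forward: the route's assembly
`hasResolution_of_thesis` (integral case, every ground field) and reduced → integral
(`DescentReducedToIntegral_holds`); backward: a resolution is a purely inseparable regular
alteration, and a finite cover of a separated finite-type `k`-scheme is one. [folklore] -/
theorem palterationThesisAt_iff_resolutionInChar (p : ℕ) (hp : p.Prime) :
    ((∀ (k : Type) [Field k] [CharP k p] (X : Scheme.{0}) (f : X ⟶ Spec (.of k)),
        IsSeparated f → LocallyOfFiniteType f → QuasiCompact f → IsIntegral X →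
        ∃ (X' : Scheme.{0}) (g : X' ⟶ X), IsProper g ∧ IsIntegral X' ∧ Scheme.IsRegular X' ∧
          Function.Surjective g.base ∧ ∃ U : X.Opens, Dense (U : Set X) ∧ IsFinite (g ∣_ U) ∧
          UniversallyInjective (g ∣_ U)) ∧
      (∀ (k : Type) [Field k] [CharP k p] (Y X : Scheme.{0}) (f : Y ⟶ Spec (.of k))
        (g : X ⟶ Y), IsSeparated f → LocallyOfFiniteType f → QuasiCompact f → IsIntegral Y →
        Scheme.IsRegular Y → IsIntegral X → IsFinite g → UniversallyInjective g →
        Function.Surjective g.base → Scheme.HasResolution X)) ↔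
    ResolutionInChar.{0} p := by
  haveI : Fact p.Prime := ⟨hp⟩
  constructor
  · rintro ⟨hPI, hPC⟩ k _ _ X f hsep hlft hqc hred
    exact DescentReducedToIntegral_holds k (fun Y g h1 h2 h3 h4 => by
      haveI := h1; haveI := h2; haveI := h3; haveI := h4
      exact hasResolution_of_thesis p hPI hPC g) X f hsep hlft hqc hred
  · intro h
    exact ⟨fun k _ _ X f hs hl hq hi => by
        haveI := hs; haveI := hl; haveI := hq; haveI := hi
        exact pialtAt_of_resolutionInChar h k X f,
      fun k _ _ Y X f g hs hl hq _hY _hreg hX hfin _hui _hsurj => by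
        haveI := hs; haveI := hl; haveI := hq; haveI := hX; haveI := hfin
        exact picoverAt_of_resolutionInChar h k Y X f g⟩

/-- **The crux `PalterationThesis` (stmt-0552) is equivalent to the summit statement
`ResolutionOfSingularities`**: forward by the route's assembly `assembly_proof` (stmt-0553, every
ground field), backward by the sandwich `palterationThesis_of_resolutionOfSingularities`. Hence the
crux is exactly summit-hard: a proof is resolution of singularities in every positive
characteristic, a refutation is a counterexample to it. [folklore] -/
theorem palterationThesis_iff_resolutionOfSingularities :
    PalterationThesis ↔ _root_.ResolutionOfSingularities :=
  ⟨fun h => assembly_proof h, palterationThesis_of_resolutionOfSingularities⟩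

/-- The summit restated inside the route: **resolution of singularities in positive characteristic
holds if and only if both the Abramovich–Oort conjecture in positive characteristic (`Pialt`,
stmt-0555) and resolution of finite radicial covers of regular varieties (`Picover`, stmt-0554)
hold.** [folklore] -/
theorem resolutionOfSingularities_iff_pialt_and_picover :
    _root_.ResolutionOfSingularities ↔ Pialt ∧ Picover :=
  palterationThesis_iff_resolutionOfSingularities.symm.trans palterationThesis_iff_pialt_and_picover

/-- For a single prime `p`: if the `p`-part of the thesis fails then resolution fails in
characteristic `p` (and conversely) — the prime-by-prime kill criterion of the route, as an
equivalence of negations. [folklore] -/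
theorem not_palterationThesisAt_iff_not_resolutionInChar (p : ℕ) (hp : p.Prime) :
    ¬ ((∀ (k : Type) [Field k] [CharP k p] (X : Scheme.{0}) (f : X ⟶ Spec (.of k)),
        IsSeparated f → LocallyOfFiniteType f → QuasiCompact f → IsIntegral X →
        ∃ (X' : Scheme.{0}) (g : X' ⟶ X), IsProper g ∧ IsIntegral X' ∧ Scheme.IsRegular X' ∧
          Function.Surjective g.base ∧ ∃ U : X.Opens, Dense (U : Set X) ∧ IsFinite (g ∣_ U) ∧
          UniversallyInjective (g ∣_ U)) ∧
      (∀ (k : Type) [Field k] [CharP k p] (Y X : Scheme.{0}) (f : Y ⟶ Spec (.of k))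
        (g : X ⟶ Y), IsSeparated f → LocallyOfFiniteType f → QuasiCompact f → IsIntegral Y →
        Scheme.IsRegular Y → IsIntegral X → IsFinite g → UniversallyInjective g →
        Function.Surjective g.base → Scheme.HasResolution X)) ↔
    ¬ ResolutionInChar.{0} p :=
  not_congr (palterationThesisAt_iff_resolutionInChar p hp)

/-- **The crux through the degree-`p` residue.** `PalterationThesis` holds if and only if `Pialt`
(purely inseparable regular alterations, stmt-0555) holds and, for every prime `p`, every regular
integral separated finite-type `W / k` (char `k = p`) and every purely inseparable extension
`L / K(W)` of degree `p`, the normalization of `W` in `L` has a resolution — the `Picover` half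
replaced by its degree-`p` residue via `picover_iff_picoverDegP` (Temkin 2013, Rem. 1.3.5 (ii):
induction on a degree-`p` tower of the radicial function field extension).
[cite: Temkin2013, Rem. 1.3.5 (ii)-(iii)] -/
theorem palterationThesis_iff_pialt_and_picoverDegP :
    PalterationThesis ↔ Pialt ∧
      (∀ (p : ℕ), p.Prime → ∀ (k : Type) [Field k] [CharP k p] (W : Scheme.{0}) [IsIntegral W]
        (f : W ⟶ Spec (.of k)) (L : Type) [Field L] [Algebra W.functionField L],
        IsSeparated f → LocallyOfFiniteType f → QuasiCompact f → Scheme.IsRegular W →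
        IsPurelyInseparable W.functionField L → Module.finrank W.functionField L = p →
        Scheme.HasResolution (normalizationIn W L)) :=
  palterationThesis_iff_pialt_and_picover.trans (and_congr_right' Picover.IffDegP.picover_iff_picoverDegP)

end Summit.ResolutionOfSingularities.ResolutionOfSingularities.Theorems
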